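/-
Copyright (c) 2026 the pub-hodgecm-mathlib formalisation cell (harness21).  Prover seat hodgecm-mathlib-K2E3-p06 (g0 → g2), Track B «K2-LIT» ∕ h413,
ENGINE E3 unit U4 «Keys», SIGS-TABLE row #6 — THE SOCKET `sig_K2E3IrregularReducibleCaseThree` (U4-c) PAID BY NAME.
-/
import Summits.HodgeConjecture.HodgeConjecture.Theorems.K2E3IrregularReducibleCaseThreeOfSkewLineIntegral   -- ★ p855477 (g0): the socket ⟸ hJ (Keys' Plancherel non-vanishing)
import Summits.HodgeConjecture.HodgeConjecture.Theorems.K2E3KeysSkewLineNonvanishingCM                   -- ★ brick F6 (g2): hJ proved (Tate's Fubini trick at `s = 0`, ★ F1–F5)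
import HarnessLib

/-!
# K2 · E3 · U4 «Keys», row #6 — `sig_K2E3IrregularReducibleCaseThree` (U4-c) PAID: at a non-split `v`, for continuous `(χ₁, χ₂)` with `w χ = χ` (`χ₁` trivial on norms),
# if `i_G(χ₁, χ₂)` has a `G`-stable `⊥ ≠ N ≠ ⊤` then `χ₁ ≠ 1` and `χ₁|_{F_v^×} = 1` [Keys1984 §7 Thm. (1); Rogawski1990 §12.2 (3)]

Cell `pub/hodgecm-mathlib` (D-0151), HCML Track B «K2-LIT», crux H413 = `stmt-HodgeConjecture-24833` (lane `--supports … --as helper`), route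
HCCMUnconditional; socket `sig_K2E3IrregularReducibleCaseThree` of `Cruxes/H413/Lines/K2_E3_EllipticInputsSigs_U4Keys.lean` (K2E3-plan; statement :139–147, bytes frozen;
the Lines-side reducible `abbrev Pl L := HeightOneSpectrum (𝓞 L⁺)` inlined, so the dealer's tie `theorem sig_… := …irregularReducibleCaseThree` is by `rfl` on types).
THEOREMS ONLY (0 def ∕ 0 instance ∕ 0 notation ∕ 0 sorry); ★-only imports (never `Cruxes/…/Lines`).

ASSEMBLY.  ★ p855477 `irregularReducibleCaseThree_of_skewLineIntegral_ne_zero` (g0: ★ Jacquet scalar of a reducible `w`-fixed `i_G(χ)`, ★ `χ₁ ≠ 1`, ★ twisted Heisenberg slice)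
reduces the socket to the single analytic letter hJ «`∫_{R⁻} ‖1+η‖⁻¹ • χ₁(σ(1+η)^)⁻¹ dμ⁻ ≠ 0` whenever `χ₁` (continuous, trivial on norms) is non-trivial on a `σ`-fixed unit»;
★ brick F6 `K2E3KeysSkewLineNonvanishingCM.skewLineIntegral_ne_zero` (g2) IS hJ, proved by Tate's Fubini trick at `s = 0` on `L_w` (★ F1 Lemma 2.4.2 at `s = 0`, ★ F2 integrability,
★ F3∕F3b fibration over the skew line and its limit, ★ F4∕F4b∕F4c the `σ`-even character, the two-bump test function and the dual zeta integral in closed form, ★ F5 the contradiction)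
— no Gauss sum evaluated, no case distinction by ramification (dyadic places included).  `χ₁` is trivial on norms by ★ `cmWeylTorusCharPair_eq_iff` (`w χ = χ`).
* **`irregularReducibleCaseThree`** — the statement of `sig_K2E3IrregularReducibleCaseThree`, token for token (`Pl` inlined).
HONEST LABEL: HC_CM is proved only modulo the 7 printed citations (2 remaining named inputs: hLiu418 = `stmt-HodgeConjecture-24832`, h413 =
`stmt-HodgeConjecture-24833`) until rung 0 closes; this file pays ONE socket (U4-c) of stub 4's minimal cone `{U4-f, U4-c}` — count-neutral for HC_CM until the tier-0 letter lands.

## References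
* [Keys1984] D. Keys, *Principal series representations of special unitary groups over local fields*, Compositio Math. 51 (1984), §5 (Plancherel measure), §7 Thm. (1) p. 126.
* [Rogawski1990] J. D. Rogawski, *Automorphic Representations of Unitary Groups in Three Variables*, Ann. of Math. Stud. 123 (1990), §12.2 (3) pp. 173–174.
* [Tate1950] J. Tate, *Fourier analysis in number fields and Hecke's zeta-functions* (1950), §2.4 Lemma 2.4.2.
-/

set_option autoImplicit false
-- the mandated namespace has the single-problem summit's repeated segment (`HodgeConjecture.HodgeConjecture`)
set_option linter.dupNamespace false

noncomputable section

open NumberField IsDedekindDomain MeasureTheory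
open scoped NNReal
open Literature.NumberTheory.Automorphic Literature.NumberTheory.Automorphic.UnitaryGroup Literature.NumberTheory.Automorphic.UnitaryGroup.HeisRing
open Literature.NumberTheory.GaloisRepresentations Literature.NumberTheory.GaloisRepresentations.IsNonarchimedeanLocalField
open Summit.HodgeConjecture.HodgeConjecture.Cruxes.H413

namespace Summit.HodgeConjecture.HodgeConjecture.Cruxes.H413.K2E3IrregularReducibleCaseThree

set_option maxHeartbeats 1600000 in
set_option synthInstance.maxHeartbeats 400000 in
open scoped Classical in
/-- **`sig_K2E3IrregularReducibleCaseThree` (U4-c) — THE IRREGULAR (UNITARY, `w χ = χ`) CASE OF KEYS' REDUCIBILITY THEOREM: reducible ⟹ `χ₁ ≠ 1` and `χ₁|_{F^×} = 1`.**  For a CM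
field `L`, a finite place `v` of `L⁺` non-split in `L`, continuous characters `(χ₁, χ₂)` of the diagonal torus of `U(Φ₃)(L⁺_v)` with `(χ₁, χ₂) = w(χ₁, χ₂)` (`χ₁(σα · α) = 1`),
if the principal series `i_G(χ₁, χ₂)` has a `G`-stable subspace `⊥ ≠ N ≠ ⊤` then `χ₁ ≠ 1` and `χ₁` is trivial on the `σ`-fixed units («the unitary principal series `Ind λ` is
reducible iff `λ ≠ 1`, `wλ = λ`, `λ|F^× = 1`» [Keys1984 §7 Thm. (1)], case (3) of [Rogawski1990 §12.2]).  ★ p855477 ∘ ★ F6: the Jacquet-module∕Heisenberg-slice reduction of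
g0 and Keys' Plancherel non-vanishing of g2 (Tate's Fubini trick at `s = 0`).  Statement = the socket's, token for token (`Pl` inlined).
[cite: Keys1984, §7 Thm. (1) p. 126; §5] [cite: Rogawski1990, §12.2 (3) pp. 173–174] [cite: Tate1950, §2.4, Lemma 2.4.2] -/
theorem irregularReducibleCaseThree :
  ∀ (L : Type) [Field L] [NumberField L] [IsCMField L] (v : HeightOneSpectrum (𝓞 ↥(maximalRealSubfield L))),
    (∀ w : PlacesOver L v, IsCMField.complexConj L • w.1 = w.1) →
    ∀ (χ₁ : (UnitaryGroup.LocalRing L v)ˣ →* ℂˣ) (χ₂ : ↥(normOneUnits (conjLocal L (IsCMField.complexConj L) v)) →* ℂˣ), Continuous (fun x => ((χ₁ x : ℂˣ) : ℂ)) → Continuous (fun x => ((χ₂ x : ℂˣ) : ℂ)) → UnitaryGroup.cmTorusCharPair L v χ₁ χ₂ = UnitaryGroup.cmTorusCharPair L v (UnitaryGroup.conjInvChar (conjLocal L (IsCMField.complexConj L) v) χ₁) χ₂ →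
      (∃ N : Subrepresentation (UnitaryGroup.cmPrincipalSeries L 3 v (UnitaryGroup.cmTorusCharPair L v χ₁ χ₂)), N ≠ ⊥ ∧ N ≠ ⊤) →
      (χ₁ ≠ 1 ∧ ∀ a : (UnitaryGroup.LocalRing L v)ˣ, (conjLocal L (IsCMField.complexConj L) v) (a : UnitaryGroup.LocalRing L v) = a → χ₁ a = 1) := by
  intro L _ _ _ v hns χ₁ χ₂ h₁ h₂ hirr hred
  have hw' : cmWeylTorusCharPair L v χ₁ χ₂ = cmTorusCharPair L v χ₁ χ₂ := (cmWeylTorusCharPair_eq L v χ₁ χ₂).trans hirr.symm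
  have hnorm := (F0P3cStCharTSWeylFixedIffNormTrivial.cmWeylTorusCharPair_eq_iff L v χ₁ χ₂).1 hw'
  exact K2E3IrregularReducibleCaseThreeOfSkewLineIntegral.irregularReducibleCaseThree_of_skewLineIntegral_ne_zero L v hns χ₁ χ₂ h₁ h₂ hirr hred
    (fun hgen _ _ μY _ _ => K2E3KeysSkewLineNonvanishingCM.skewLineIntegral_ne_zero L v hns χ₁ h₁ hnorm hgen μY)

end Summit.HodgeConjecture.HodgeConjecture.Cruxes.H413.K2E3IrregularReducibleCaseThree

end
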